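import Summits.QuantumFields.YangMills.Theorems.UnitScaleTiltProp7HermiteCardinalWeights
import HarnessLib

/-!
# Route `UnitScaleTilt`, crux K1 «MinimiserStabilityRegPr» (stmt-QuantumFields-19200), route-R E′ path (α′), row LEMMA-H-CURVED — FILE 3γ:
# SUPPORT AND TOTAL MASS OF THE CARDINAL WEIGHTS: `E_ν(x,t) = 0` off `t ∈ {Q_ν(x), Q_ν(x)+1}`, `Σ_t|∂_νE_ν(x,t)| ≤ 6∕ℓ`, `Σ_t|Δ²_νE_ν(x,t)| ≤ 24∕ℓ²`, and for the product
# weights `Σ_y|∂_μW_y(x)| ≤ 6∕ℓ`, `Σ_y|Δ²_μW_y(x)| ≤ 24∕ℓ²` — the rows that turn the master pointwise bound of ✓ `Prop7HermiteCornerBlendCov` into an energy bound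

Cell `ym3-torus`, D-0154 (3c) twin-width seat `ym-routeR-w1` (gen 5); row "routeR-w1 g5: LEMMA-H-CURVED" (namer ★ym-ust-19200-p1 g14, 2026-08-28 17:33Z; design of record
(x2′-corner)).  THEOREMS ONLY (0 `def`, 0 `sorry`); `--supports stmt-QuantumFields-19200`, count-neutral.  YM₃ on T³ is a ladder rung (R3), not the Clay problem; nothing here
claims a stub, the crux, d = 4 or the mass gap.

WHY.  The master bound ✓ `Prop7HermiteCornerBlendCov.norm_lap_cornerBlend_le` weighs the frame rows by `|W_y(x)|` (a partition of unity — Jensen), by the weight GRADIENTS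
`|∂_μW_y(x)|` and by the weight SECOND DIFFERENCES `|Δ²_μW_y(x)|`.  For the last two the energy count needs their TOTAL MASS over `y` at fixed `x` (not only the pointwise rows
of ✓ `Prop7HermiteCardinalWeights`): since `W_y = Π_ν E_ν(·, y_ν)` and only the `μ`-factor moves under a `μ`-step, `Σ_y |∂_μW_y(x)| = (Σ_t |∂_μE_μ(x,t)|)·Π_(ν≠μ)(Σ_t E_ν) =
Σ_t|∂_μE_μ(x,t)|` and likewise for `Δ²_μ`; and `E_μ(·,t)` being ONE Hermite step of the indicator `𝟙[Q_μ = t]`, its first∕second differences are the profile's differences times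
indicator differences (✓ `Prop7HermiteSecondDiff` Sect. 1–2), whose sum over `t` is at most `2` resp. `4` indicator masses.

WHAT IS PROVED (ns `…Theorems.Prop7HermiteCardinalWeightsMass`; `ℓ = L^k`, profile `p` abstract with displayed rows).
* §1 `weightE_eq_zero_of_ne` (support), `sum_ind_eq_one` (`Σ_t 𝟙[Q_ν(z) = t] = 1`), ★ `sum_abs_diff_weightE_le` (`≤ 6∕ℓ`), ★ `sum_abs_secondDiff_weightE_le` (`≤ 24∕ℓ²`).
* §2 `sum_prod_factor` (`Σ_y F(y_μ)·Π_(ν≠μ)G_ν(y_ν) = (Σ_tF)·Π_(ν≠μ)Σ_tG_ν`), `diff_weight_eq` (the `μ`-gradient factors through `E_μ`), ★★ `sum_abs_diff_weight_le` (`Σ_y|∂_μW_y(x)| ≤ 6∕ℓ`),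
  ★★ `sum_abs_secondDiff_weight_le` (`Σ_y|Δ²_μW_y(x)| ≤ 24∕ℓ²`).
HONEST SCOPE.  Flat bookkeeping; nothing of Bałaban's is asserted.

References: T. Bałaban, CMP 95 (1984) 17–40 [Balaban1984PropagatorsI] ((1.18) p.20, (1.29)–(1.31) p.23).
-/

set_option autoImplicit false

noncomputable section

open scoped BigOperators

namespace Summit.QuantumFields.YangMills.Theorems.Prop7HermiteCardinalWeightsMass

open Literature.MathematicalPhysics.QuantumFieldTheory.Balaban1983to89
open Finset
open Summit.QuantumFields.YangMills.Theorems.Prop7TentInterpolation (shift_eq_update)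
open Summit.QuantumFields.YangMills.Theorems.Prop7HermiteSecondDiff (hermStep_self_eq hermStep_shift_eq abs_secondDiff_hermStep_le)
open Summit.QuantumFields.YangMills.Theorems.Prop7HermiteCardinalWeights (ind_runConst hermStep_ind_eq sum_weightE weightE_update_ne secondDiff_weight_eq
  iterBlockOf_apply_longShift)
open B5Eq118OneStroke (iterBlockOf)

variable {P : Params} {k : ℕ} (hk : k ≤ P.m + P.K) (h : ZMod (P.sitesPerDir 0)) (p : ℕ → ℝ)

/-! ## §1 Support and total mass of the factor `E_ν` -/

section Factor

omit hk in
/-- **SUPPORT**: `E_ν(x,t) = 0` unless `t = Q_ν(x)` or `t = Q_ν(x) + 1`. [folklore] -/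
theorem weightE_eq_zero_of_ne (ν : Fin P.d) (t : ZMod (P.sitesPerDir k)) (x : Site P 0) (h1 : (iterBlockOf k (fun κ => x κ - h)) ν ≠ t) (h2 : (iterBlockOf k (fun κ => x κ - h)) ν + 1 ≠ t) :
    (p ((x ν - h).val % P.L ^ k) * (if (iterBlockOf k (fun κ => x κ - h)) ν = t then (1 : ℝ) else 0) + (1 - p ((x ν - h).val % P.L ^ k)) * (if (iterBlockOf k (fun κ => x κ - h)) ν + 1 = t then (1 : ℝ) else 0)) = 0 := by
  rw [if_neg h1, if_neg h2]; ring

omit hk in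
/-- `Σ_t 𝟙[Q_ν(z) = t] = 1`. [folklore] -/
theorem sum_ind_eq_one (ν : Fin P.d) (z : Site P 0) : ∑ t : ZMod (P.sitesPerDir k), (if (iterBlockOf k (fun κ => z κ - h)) ν = t then (1 : ℝ) else 0) = 1 := by
  rw [Finset.sum_ite_eq]; simp

omit hk in
/-- `Σ_t |𝟙[Q_ν(a) = t] − 𝟙[Q_ν(b) = t]| ≤ 2`. [folklore] -/
theorem sum_abs_ind_sub_le (ν : Fin P.d) (a b : Site P 0) :
    ∑ t : ZMod (P.sitesPerDir k), |(if (iterBlockOf k (fun κ => a κ - h)) ν = t then (1 : ℝ) else 0) - (if (iterBlockOf k (fun κ => b κ - h)) ν = t then (1 : ℝ) else 0)| ≤ 2 := by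
  have hpt : ∀ t : ZMod (P.sitesPerDir k), |(if (iterBlockOf k (fun κ => a κ - h)) ν = t then (1 : ℝ) else 0) - (if (iterBlockOf k (fun κ => b κ - h)) ν = t then (1 : ℝ) else 0)|
      ≤ (if (iterBlockOf k (fun κ => a κ - h)) ν = t then (1 : ℝ) else 0) + (if (iterBlockOf k (fun κ => b κ - h)) ν = t then (1 : ℝ) else 0) := by
    intro t; split_ifs <;> norm_num
  refine (Finset.sum_le_sum fun t _ => hpt t).trans ?_
  rw [Finset.sum_add_distrib, sum_ind_eq_one h ν a, sum_ind_eq_one h ν b]; norm_num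

include hk

/-- ★ **TOTAL MASS OF THE GRADIENT**: `Σ_t |E_ν(x+e_ν,t) − E_ν(x,t)| ≤ 6∕ℓ` (slope row `|p(r+1) − p(r)| ≤ 3∕ℓ`, `p(0) = 1`, `p(ℓ) = 0`). [cite: Balaban1984PropagatorsI, (1.29)-(1.31) p.23] -/
theorem sum_abs_diff_weightE_le (hp0 : p 0 = 1) (hpℓ : p (P.L ^ k) = 0) (hpS : ∀ r : ℕ, r + 1 ≤ P.L ^ k → |p (r + 1) - p r| ≤ 3 / (((P.L ^ k : ℕ) : ℝ)))
    (ν : Fin P.d) (x : Site P 0) :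
    ∑ t : ZMod (P.sitesPerDir k), |(p (((x.shift ν) ν - h).val % P.L ^ k) * (if (iterBlockOf k (fun κ => (x.shift ν) κ - h)) ν = t then (1 : ℝ) else 0) + (1 - p (((x.shift ν) ν - h).val % P.L ^ k)) * (if (iterBlockOf k (fun κ => (x.shift ν) κ - h)) ν + 1 = t then (1 : ℝ) else 0)) - (p ((x ν - h).val % P.L ^ k) * (if (iterBlockOf k (fun κ => x κ - h)) ν = t then (1 : ℝ) else 0) + (1 - p ((x ν - h).val % P.L ^ k)) * (if (iterBlockOf k (fun κ => x κ - h)) ν + 1 = t then (1 : ℝ) else 0))| ≤ 6 / (((P.L ^ k : ℕ) : ℝ)) := by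
  have hℓN : P.L ^ k ∣ P.sitesPerDir 0 := ⟨P.sitesPerDir k, by
    unfold Params.sitesPerDir; rw [Nat.sub_zero, mul_left_comm, ← pow_add, Nat.add_sub_cancel' hk]⟩
  have hℓ : 0 < P.L ^ k := pow_pos P.L_pos k
  have hr : (x ν - h).val % P.L ^ k + 1 ≤ P.L ^ k := Nat.mod_lt _ hℓ
  have hpt : ∀ t : ZMod (P.sitesPerDir k), (p (((x.shift ν) ν - h).val % P.L ^ k) * (if (iterBlockOf k (fun κ => (x.shift ν) κ - h)) ν = t then (1 : ℝ) else 0) + (1 - p (((x.shift ν) ν - h).val % P.L ^ k)) * (if (iterBlockOf k (fun κ => (x.shift ν) κ - h)) ν + 1 = t then (1 : ℝ) else 0)) - (p ((x ν - h).val % P.L ^ k) * (if (iterBlockOf k (fun κ => x κ - h)) ν = t then (1 : ℝ) else 0) + (1 - p ((x ν - h).val % P.L ^ k)) * (if (iterBlockOf k (fun κ => x κ - h)) ν + 1 = t then (1 : ℝ) else 0))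
      = (p ((x ν - h).val % P.L ^ k + 1) - p ((x ν - h).val % P.L ^ k)) * ((fun z : Site P 0 => if (iterBlockOf k (fun κ => z κ - h)) ν = t then (1 : ℝ) else 0) x - (fun z : Site P 0 => if (iterBlockOf k (fun κ => z κ - h)) ν = t then (1 : ℝ) else 0) (Function.update x ν (x ν + ((P.L ^ k : ℕ) : ZMod (P.sitesPerDir 0))))) := by
    intro t
    have hw := fun z => ind_runConst hk h ν ν t z
    rw [← hermStep_ind_eq hk h p ν t (x.shift ν), ← hermStep_ind_eq hk h p ν t x,
      hermStep_shift_eq (P.L ^ k) h p hℓN hℓ hp0 hpℓ ν _ hw x, hermStep_self_eq (P.L ^ k) h p hℓN ν _ hw x]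
    ring
  simp only [hpt, abs_mul]
  rw [← Finset.mul_sum]
  have hs := sum_abs_ind_sub_le (k := k) h ν x (Function.update x ν (x ν + ((P.L ^ k : ℕ) : ZMod (P.sitesPerDir 0))))
  have h3 := hpS _ hr
  have h0 : 0 ≤ |p ((x ν - h).val % P.L ^ k + 1) - p ((x ν - h).val % P.L ^ k)| := abs_nonneg _
  calc |p ((x ν - h).val % P.L ^ k + 1) - p ((x ν - h).val % P.L ^ k)| * ∑ t : ZMod (P.sitesPerDir k), |(fun z : Site P 0 => if (iterBlockOf k (fun κ => z κ - h)) ν = t then (1 : ℝ) else 0) x - (fun z : Site P 0 => if (iterBlockOf k (fun κ => z κ - h)) ν = t then (1 : ℝ) else 0) (Function.update x ν (x ν + ((P.L ^ k : ℕ) : ZMod (P.sitesPerDir 0))))|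
      ≤ 3 / (((P.L ^ k : ℕ) : ℝ)) * 2 := mul_le_mul h3 (by simpa only using hs) (Finset.sum_nonneg fun _ _ => abs_nonneg _) (by positivity)
    _ = 6 / (((P.L ^ k : ℕ) : ℝ)) := by ring

/-- ★ **TOTAL MASS OF THE SECOND DIFFERENCE**: `Σ_t |E_ν(x+e_ν,t) − 2E_ν(x,t) + E_ν(x−e_ν,t)| ≤ 24∕ℓ²`. [cite: Balaban1984PropagatorsI, (1.29)-(1.31) p.23] -/
theorem sum_abs_secondDiff_weightE_le (hp0 : p 0 = 1) (hpℓ : p (P.L ^ k) = 0)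
    (hpD : ∀ r : ℕ, 1 ≤ r → r + 1 ≤ P.L ^ k → |p (r + 1) - 2 * p r + p (r - 1)| ≤ 6 / (((P.L ^ k : ℕ) : ℝ)) ^ 2)
    (hpc : p 1 + p (P.L ^ k - 1) = 1) (hpk0 : 0 ≤ p (P.L ^ k - 1)) (hpk : p (P.L ^ k - 1) ≤ 3 / (((P.L ^ k : ℕ) : ℝ)) ^ 2)
    (ν : Fin P.d) (x : Site P 0) :
    ∑ t : ZMod (P.sitesPerDir k), |(p (((x.shift ν) ν - h).val % P.L ^ k) * (if (iterBlockOf k (fun κ => (x.shift ν) κ - h)) ν = t then (1 : ℝ) else 0) + (1 - p (((x.shift ν) ν - h).val % P.L ^ k)) * (if (iterBlockOf k (fun κ => (x.shift ν) κ - h)) ν + 1 = t then (1 : ℝ) else 0)) - 2 * (p ((x ν - h).val % P.L ^ k) * (if (iterBlockOf k (fun κ => x κ - h)) ν = t then (1 : ℝ) else 0) + (1 - p ((x ν - h).val % P.L ^ k)) * (if (iterBlockOf k (fun κ => x κ - h)) ν + 1 = t then (1 : ℝ) else 0)) + (p (((x.unshift ν) ν - h).val % P.L ^ k) * (if (iterBlockOf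 k (fun κ => (x.unshift ν) κ - h)) ν = t then (1 : ℝ) else 0) + (1 - p (((x.unshift ν) ν - h).val % P.L ^ k)) * (if (iterBlockOf k (fun κ => (x.unshift ν) κ - h)) ν + 1 = t then (1 : ℝ) else 0))| ≤ 24 / (((P.L ^ k : ℕ) : ℝ)) ^ 2 := by
  have hℓN : P.L ^ k ∣ P.sitesPerDir 0 := ⟨P.sitesPerDir k, by
    unfold Params.sitesPerDir; rw [Nat.sub_zero, mul_left_comm, ← pow_add, Nat.add_sub_cancel' hk]⟩
  have hℓ : 0 < P.L ^ k := pow_pos P.L_pos k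
  have hpt : ∀ t : ZMod (P.sitesPerDir k), |(p (((x.shift ν) ν - h).val % P.L ^ k) * (if (iterBlockOf k (fun κ => (x.shift ν) κ - h)) ν = t then (1 : ℝ) else 0) + (1 - p (((x.shift ν) ν - h).val % P.L ^ k)) * (if (iterBlockOf k (fun κ => (x.shift ν) κ - h)) ν + 1 = t then (1 : ℝ) else 0)) - 2 * (p ((x ν - h).val % P.L ^ k) * (if (iterBlockOf k (fun κ => x κ - h)) ν = t then (1 : ℝ) else 0) + (1 - p ((x ν - h).val % P.L ^ k)) * (if (iterBlockOf k (fun κ => x κ - h)) ν + 1 = t then (1 : ℝ) else 0)) + (p (((x.unshift ν) ν - h).val % P.L ^ k) * (if (iterBlockOf k (fun κ => (x.unshift ν) κ - h)) ν = t then (1 : ℝ) else 0) + (1 - p (((x.unshift ν) ν - h).val % P.L ^ k)) * (if (iterBlockOf k (fun κ => (x.unshift ν) κ - h)) ν + 1 = t then (1 : ℝ) else 0))|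
      ≤ 6 / (((P.L ^ k : ℕ) : ℝ)) ^ 2 * (|(fun z : Site P 0 => if (iterBlockOf k (fun κ => z κ - h)) ν = t then (1 : ℝ) else 0) (Function.update x ν (x ν + ((P.L ^ k : ℕ) : ZMod (P.sitesPerDir 0)))) - (fun z : Site P 0 => if (iterBlockOf k (fun κ => z κ - h)) ν = t then (1 : ℝ) else 0) x| + |(fun z : Site P 0 => if (iterBlockOf k (fun κ => z κ - h)) ν = t then (1 : ℝ) else 0) x - (fun z : Site P 0 => if (iterBlockOf k (fun κ => z κ - h)) ν = t then (1 : ℝ) else 0) (Function.update x ν (x ν - ((P.L ^ k : ℕ) : ZMod (P.sitesPerDir 0))))|) := by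
    intro t
    rw [← hermStep_ind_eq hk h p ν t (x.shift ν), ← hermStep_ind_eq hk h p ν t x, ← hermStep_ind_eq hk h p ν t (x.unshift ν)]
    exact abs_secondDiff_hermStep_le (P.L ^ k) h p hℓN hℓ hp0 hpℓ hpD hpc hpk0 hpk ν (fun z : Site P 0 => if (iterBlockOf k (fun κ => z κ - h)) ν = t then (1 : ℝ) else 0) (fun z => ind_runConst hk h ν ν t z) x
  refine (Finset.sum_le_sum fun t _ => hpt t).trans ?_
  rw [← Finset.mul_sum, Finset.sum_add_distrib]
  have h1 := sum_abs_ind_sub_le (k := k) h ν (Function.update x ν (x ν + ((P.L ^ k : ℕ) : ZMod (P.sitesPerDir 0)))) x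
  have h2 := sum_abs_ind_sub_le (k := k) h ν x (Function.update x ν (x ν - ((P.L ^ k : ℕ) : ZMod (P.sitesPerDir 0))))
  have h62 : (0 : ℝ) ≤ 6 / (((P.L ^ k : ℕ) : ℝ)) ^ 2 := by positivity
  calc 6 / (((P.L ^ k : ℕ) : ℝ)) ^ 2 * (∑ t : ZMod (P.sitesPerDir k), |(fun z : Site P 0 => if (iterBlockOf k (fun κ => z κ - h)) ν = t then (1 : ℝ) else 0) (Function.update x ν (x ν + ((P.L ^ k : ℕ) : ZMod (P.sitesPerDir 0)))) - (fun z : Site P 0 => if (iterBlockOf k (fun κ => z κ - h)) ν = t then (1 : ℝ) else 0) x| + ∑ t : ZMod (P.sitesPerDir k), |(fun z : Site P 0 => if (iterBlockOf k (fun κ => z κ - h)) ν = t then (1 : ℝ) else 0) x - (fun z : Site P 0 => if (iterBlockOf k (fun κ => z κ - h)) ν = t then (1 : ℝ) else 0) (Function.update x ν (x ν - ((P.L ^ k : ℕ) : ZMod (P.sitesPerDir 0))))|)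
      ≤ 6 / (((P.L ^ k : ℕ) : ℝ)) ^ 2 * (2 + 2) := by
        refine mul_le_mul_of_nonneg_left (add_le_add ?_ ?_) h62
        · simpa only using h1
        · simpa only using h2
    _ = 24 / (((P.L ^ k : ℕ) : ℝ)) ^ 2 := by ring

end Factor

/-! ## §2 Total mass of the product weights -/

section Weight

/-- **SUM OF A PRODUCT WITH ONE DISTINGUISHED FACTOR**: `Σ_y F(y_μ)·Π_(ν≠μ) G_ν(y_ν) = (Σ_t F(t))·Π_(ν≠μ)(Σ_t G_ν(t))`. [folklore] -/
theorem sum_prod_factor (μ : Fin P.d) (F : ZMod (P.sitesPerDir k) → ℝ) (G : Fin P.d → ZMod (P.sitesPerDir k) → ℝ) :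
    ∑ y : Site P k, F (y μ) * ∏ ν ∈ Finset.univ.erase μ, G ν (y ν)
      = (∑ t : ZMod (P.sitesPerDir k), F t) * ∏ ν ∈ Finset.univ.erase μ, ∑ t : ZMod (P.sitesPerDir k), G ν t := by
  have h1 : ∀ y : Site P k, F (y μ) * ∏ ν ∈ Finset.univ.erase μ, G ν (y ν) = ∏ ν : Fin P.d, (Function.update G μ F) ν (y ν) := by
    intro y
    rw [← Finset.mul_prod_erase Finset.univ (fun ν => (Function.update G μ F) ν (y ν)) (Finset.mem_univ μ), Function.update_self]
    congr 1
    exact Finset.prod_congr rfl fun ν hν => by rw [Function.update_of_ne (Finset.mem_erase.mp hν).1]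
  have h2 : (∑ t : ZMod (P.sitesPerDir k), F t) * ∏ ν ∈ Finset.univ.erase μ, ∑ t : ZMod (P.sitesPerDir k), G ν t
      = ∏ ν : Fin P.d, ∑ t : ZMod (P.sitesPerDir k), (Function.update G μ F) ν t := by
    rw [← Finset.mul_prod_erase Finset.univ (fun ν => ∑ t : ZMod (P.sitesPerDir k), (Function.update G μ F) ν t) (Finset.mem_univ μ), Function.update_self]
    congr 1
    exact Finset.prod_congr rfl fun ν hν => by rw [Function.update_of_ne (Finset.mem_erase.mp hν).1]
  simp only [h1]
  rw [h2, Finset.prod_univ_sum]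
  rfl

include hk

/-- the `μ`-gradient of the weight factors through `E_μ`: `W_y(x+e_μ) − W_y(x) = (E_μ(x+e_μ, y_μ) − E_μ(x, y_μ))·Π_(ν≠μ)E_ν(x, y_ν)`. [folklore] -/
theorem diff_weight_eq (y : Site P k) (μ : Fin P.d) (x : Site P 0) :
    (∏ ν : Fin P.d, (p (((x.shift μ) ν - h).val % P.L ^ k) * (if (iterBlockOf k (fun κ => (x.shift μ) κ - h)) ν = y ν then (1 : ℝ) else 0) + (1 - p (((x.shift μ) ν - h).val % P.L ^ k)) * (if (iterBlockOf k (fun κ => (x.shift μ) κ - h)) ν + 1 = y ν then (1 : ℝ) else 0))) - (∏ ν : Fin P.d, (p ((x ν - h).val % P.L ^ k) * (if (iterBlockOf k (fun κ => x κ - h)) ν = y ν then (1 : ℝ) else 0) + (1 - p ((x ν - h).val % P.L ^ k)) * (if (iterBlockOf k (fun κ => x κ - h)) ν + 1 = y ν then (1 : ℝ) else 0))) = ((p (((x.shift μ) μ - h).val % P.L ^ k) * (if (iterBlockOf k (fun κ => (x.shift μ) κ - h)) μ = y μ then (1 : ℝ) else 0) + (1 - p (((x.shift μ) μ - h).val %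 P.L ^ k)) * (if (iterBlockOf k (fun κ => (x.shift μ) κ - h)) μ + 1 = y μ then (1 : ℝ) else 0)) - (p ((x μ - h).val % P.L ^ k) * (if (iterBlockOf k (fun κ => x κ - h)) μ = y μ then (1 : ℝ) else 0) + (1 - p ((x μ - h).val % P.L ^ k)) * (if (iterBlockOf k (fun κ => x κ - h)) μ + 1 = y μ then (1 : ℝ) else 0))) * ∏ ν ∈ Finset.univ.erase μ, (p ((x ν - h).val % P.L ^ k) * (if (iterBlockOf k (fun κ => x κ - h)) ν = y ν then (1 : ℝ) else 0) + (1 - p ((x ν - h).val % P.L ^ k)) * (if (iterBlockOf k (fun κ => x κ - h)) ν + 1 = y ν then (1 : ℝ) else 0)) := by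
  have hs : ∀ ν ∈ Finset.univ.erase μ, (p (((x.shift μ) ν - h).val % P.L ^ k) * (if (iterBlockOf k (fun κ => (x.shift μ) κ - h)) ν = y ν then (1 : ℝ) else 0) + (1 - p (((x.shift μ) ν - h).val % P.L ^ k)) * (if (iterBlockOf k (fun κ => (x.shift μ) κ - h)) ν + 1 = y ν then (1 : ℝ) else 0)) = (p ((x ν - h).val % P.L ^ k) * (if (iterBlockOf k (fun κ => x κ - h)) ν = y ν then (1 : ℝ) else 0) + (1 - p ((x ν - h).val % P.L ^ k)) * (if (iterBlockOf k (fun κ => x κ - h)) ν + 1 = y ν then (1 : ℝ) else 0)) := by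
    intro ν hν
    have hμν : μ ≠ ν := fun e => (Finset.mem_erase.mp hν).1 e.symm
    rw [shift_eq_update]
    exact weightE_update_ne hk h p hμν (y ν) x _
  rw [← Finset.mul_prod_erase (Finset.univ) (fun ν => (p (((x.shift μ) ν - h).val % P.L ^ k) * (if (iterBlockOf k (fun κ => (x.shift μ) κ - h)) ν = y ν then (1 : ℝ) else 0) + (1 - p (((x.shift μ) ν - h).val % P.L ^ k)) * (if (iterBlockOf k (fun κ => (x.shift μ) κ - h)) ν + 1 = y ν then (1 : ℝ) else 0))) (Finset.mem_univ μ),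
    ← Finset.mul_prod_erase (Finset.univ) (fun ν => (p ((x ν - h).val % P.L ^ k) * (if (iterBlockOf k (fun κ => x κ - h)) ν = y ν then (1 : ℝ) else 0) + (1 - p ((x ν - h).val % P.L ^ k)) * (if (iterBlockOf k (fun κ => x κ - h)) ν + 1 = y ν then (1 : ℝ) else 0))) (Finset.mem_univ μ), Finset.prod_congr rfl hs]
  ring

/-- ★★ **TOTAL MASS OF THE WEIGHT GRADIENT**: `Σ_y |W_y(x+e_μ) − W_y(x)| ≤ 6∕ℓ`. [cite: Balaban1984PropagatorsI, (1.29)-(1.31) p.23] -/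
theorem sum_abs_diff_weight_le (hp0 : p 0 = 1) (hpℓ : p (P.L ^ k) = 0) (hp01 : ∀ r : ℕ, r < P.L ^ k → 0 ≤ p r ∧ p r ≤ 1)
    (hpS : ∀ r : ℕ, r + 1 ≤ P.L ^ k → |p (r + 1) - p r| ≤ 3 / (((P.L ^ k : ℕ) : ℝ))) (μ : Fin P.d) (x : Site P 0) :
    ∑ y : Site P k, |(∏ ν : Fin P.d, (p (((x.shift μ) ν - h).val % P.L ^ k) * (if (iterBlockOf k (fun κ => (x.shift μ) κ - h)) ν = y ν then (1 : ℝ) else 0) + (1 - p (((x.shift μ) ν - h).val % P.L ^ k)) * (if (iterBlockOf k (fun κ => (x.shift μ) κ - h)) ν + 1 = y ν then (1 : ℝ) else 0))) - (∏ ν : Fin P.d, (p ((x ν - h).val % P.L ^ k) * (if (iterBlockOf k (fun κ => x κ - h)) ν = y ν then (1 : ℝ) else 0) + (1 - p ((x ν - h).val % P.L ^ k)) * (if (iterBlockOf k (fun κ => x κ - h)) ν + 1 = y ν then (1 : ℝ) else 0)))| ≤ 6 / (((P.L ^ k : ℕ) : ℝ)) := by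
  have hnn : ∀ (ν : Fin P.d) (t : ZMod (P.sitesPerDir k)), 0 ≤ (p ((x ν - h).val % P.L ^ k) * (if (iterBlockOf k (fun κ => x κ - h)) ν = t then (1 : ℝ) else 0) + (1 - p ((x ν - h).val % P.L ^ k)) * (if (iterBlockOf k (fun κ => x κ - h)) ν + 1 = t then (1 : ℝ) else 0)) :=
    fun ν t => Prop7HermiteCardinalWeights.weightE_nonneg h p hp01 ν t x
  have hpt : ∀ y : Site P k, |(∏ ν : Fin P.d, (p (((x.shift μ) ν - h).val % P.L ^ k) * (if (iterBlockOf k (fun κ => (x.shift μ) κ - h)) ν = y ν then (1 : ℝ) else 0) + (1 - p (((x.shift μ) ν - h).val % P.L ^ k)) * (if (iterBlockOf k (fun κ => (x.shift μ) κ - h)) ν + 1 = y ν then (1 : ℝ) else 0))) - (∏ ν : Fin P.d, (p ((x ν - h).val % P.L ^ k) * (if (iterBlockOf k (fun κ => x κ - h)) ν = y ν then (1 : ℝ) else 0) + (1 - p ((x ν - h).val % P.L ^ k)) * (if (iterBlockOf k (fun κ => x κ - h)) ν + 1 = y ν then (1 : ℝ) else 0)))| = |(p (((x.shift μ) μ -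 h).val % P.L ^ k) * (if (iterBlockOf k (fun κ => (x.shift μ) κ - h)) μ = y μ then (1 : ℝ) else 0) + (1 - p (((x.shift μ) μ - h).val % P.L ^ k)) * (if (iterBlockOf k (fun κ => (x.shift μ) κ - h)) μ + 1 = y μ then (1 : ℝ) else 0)) - (p ((x μ - h).val % P.L ^ k) * (if (iterBlockOf k (fun κ => x κ - h)) μ = y μ then (1 : ℝ) else 0) + (1 - p ((x μ - h).val % P.L ^ k)) * (if (iterBlockOf k (fun κ => x κ - h)) μ + 1 = y μ then (1 : ℝ) else 0))| * ∏ ν ∈ Finset.univ.erase μ, (p ((x ν - h).val % P.L ^ k) * (if (iterBlockOf k (fun κ => x κ - h)) ν = y ν then (1 : ℝ) else 0) + (1 - p ((x ν - h).val % P.L ^ k)) * (if (iterBlockOf k (fun κ => x κ - h)) ν + 1 = y ν then (1 : ℝ) else 0)) := by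
    intro y
    rw [diff_weight_eq hk h p y μ x, abs_mul, abs_of_nonneg (Finset.prod_nonneg fun ν _ => hnn ν (y ν))]
  simp only [hpt]
  rw [sum_prod_factor μ (fun t => |(p (((x.shift μ) μ - h).val % P.L ^ k) * (if (iterBlockOf k (fun κ => (x.shift μ) κ - h)) μ = t then (1 : ℝ) else 0) + (1 - p (((x.shift μ) μ - h).val % P.L ^ k)) * (if (iterBlockOf k (fun κ => (x.shift μ) κ - h)) μ + 1 = t then (1 : ℝ) else 0)) - (p ((x μ - h).val % P.L ^ k) * (if (iterBlockOf k (fun κ => x κ - h)) μ = t then (1 : ℝ) else 0) + (1 - p ((x μ - h).val % P.L ^ k)) * (if (iterBlockOf k (fun κ => x κ - h)) μ + 1 = t then (1 : ℝ) else 0))|) (fun ν t => (p ((x ν - h).val % P.L ^ k) * (if (iterBlockOf k (fun κ => x κ - h)) ν = t then (1 : ℝ) else 0) + (1 - p ((x ν - h).val % P.L ^ k)) * (if (iterBlockOf k (fun κ => x κ - h)) ν + 1 = t then (1 : ℝ) else 0)))]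
  have hG : ∏ ν ∈ Finset.univ.erase μ, ∑ t : ZMod (P.sitesPerDir k), (p ((x ν - h).val % P.L ^ k) * (if (iterBlockOf k (fun κ => x κ - h)) ν = t then (1 : ℝ) else 0) + (1 - p ((x ν - h).val % P.L ^ k)) * (if (iterBlockOf k (fun κ => x κ - h)) ν + 1 = t then (1 : ℝ) else 0)) = 1 :=
    Finset.prod_eq_one fun ν _ => sum_weightE h p ν x
  rw [hG, mul_one]
  exact sum_abs_diff_weightE_le hk h p hp0 hpℓ hpS μ x

/-- ★★ **TOTAL MASS OF THE WEIGHT SECOND DIFFERENCE**: `Σ_y |W_y(x+e_μ) − 2W_y(x) + W_y(x−e_μ)| ≤ 24∕ℓ²`. [cite: Balaban1984PropagatorsI, (1.29)-(1.31) p.23] -/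
theorem sum_abs_secondDiff_weight_le (hp0 : p 0 = 1) (hpℓ : p (P.L ^ k) = 0) (hp01 : ∀ r : ℕ, r < P.L ^ k → 0 ≤ p r ∧ p r ≤ 1)
    (hpD : ∀ r : ℕ, 1 ≤ r → r + 1 ≤ P.L ^ k → |p (r + 1) - 2 * p r + p (r - 1)| ≤ 6 / (((P.L ^ k : ℕ) : ℝ)) ^ 2)
    (hpc : p 1 + p (P.L ^ k - 1) = 1) (hpk : p (P.L ^ k - 1) ≤ 3 / (((P.L ^ k : ℕ) : ℝ)) ^ 2) (μ : Fin P.d) (x : Site P 0) :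
    ∑ y : Site P k, |(∏ ν : Fin P.d, (p (((x.shift μ) ν - h).val % P.L ^ k) * (if (iterBlockOf k (fun κ => (x.shift μ) κ - h)) ν = y ν then (1 : ℝ) else 0) + (1 - p (((x.shift μ) ν - h).val % P.L ^ k)) * (if (iterBlockOf k (fun κ => (x.shift μ) κ - h)) ν + 1 = y ν then (1 : ℝ) else 0))) - 2 * (∏ ν : Fin P.d, (p ((x ν - h).val % P.L ^ k) * (if (iterBlockOf k (fun κ => x κ - h)) ν = y ν then (1 : ℝ) else 0) + (1 - p ((x ν - h).val % P.L ^ k)) * (if (iterBlockOf k (fun κ => x κ - h)) ν + 1 = y ν then (1 : ℝ) else 0))) + (∏ ν : Fin P.d, (p (((x.unshift μ) ν - h).val % P.L ^ k) * (if (iterBlockOf k (fun κ => (x.unshift μ) κ - h)) ν = y ν then (1 : ℝ) else 0) + (1 - p (((x.unshift μ) ν - h).val % P.L ^ k)) * (if (iterBlockOf k (fun κ => (x.unshift μ) κ - h)) ν + 1 = y ν then (1 : ℝ) else 0)))| ≤ 24 / (((P.L ^ k : ℕ) : ℝ)) ^ 2 := by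
  have hpk0 : 0 ≤ p (P.L ^ k - 1) := (hp01 _ (by have := pow_pos P.L_pos k; omega)).1
  have hnn : ∀ (ν : Fin P.d) (t : ZMod (P.sitesPerDir k)), 0 ≤ (p ((x ν - h).val % P.L ^ k) * (if (iterBlockOf k (fun κ => x κ - h)) ν = t then (1 : ℝ) else 0) + (1 - p ((x ν - h).val % P.L ^ k)) * (if (iterBlockOf k (fun κ => x κ - h)) ν + 1 = t then (1 : ℝ) else 0)) :=
    fun ν t => Prop7HermiteCardinalWeights.weightE_nonneg h p hp01 ν t x
  have hpt : ∀ y : Site P k, |(∏ ν : Fin P.d, (p (((x.shift μ) ν - h).val % P.L ^ k) * (if (iterBlockOf k (fun κ => (x.shift μ) κ - h)) ν = y ν then (1 : ℝ) else 0) + (1 - p (((x.shift μ) ν - h).val % P.L ^ k)) * (if (iterBlockOf k (fun κ => (x.shift μ) κ - h)) ν + 1 = y ν then (1 : ℝ) else 0))) - 2 * (∏ ν : Fin P.d, (p ((x ν - h).val % P.L ^ k) * (if (iterBlockOf k (fun κ => x κ - h)) ν = y ν then (1 : ℝ) else 0) + (1 - p ((x ν - h).val % P.L ^ k)) * (if (iterBlockOf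 k (fun κ => x κ - h)) ν + 1 = y ν then (1 : ℝ) else 0))) + (∏ ν : Fin P.d, (p (((x.unshift μ) ν - h).val % P.L ^ k) * (if (iterBlockOf k (fun κ => (x.unshift μ) κ - h)) ν = y ν then (1 : ℝ) else 0) + (1 - p (((x.unshift μ) ν - h).val % P.L ^ k)) * (if (iterBlockOf k (fun κ => (x.unshift μ) κ - h)) ν + 1 = y ν then (1 : ℝ) else 0)))| = |(p (((x.shift μ) μ - h).val % P.L ^ k) * (if (iterBlockOf k (fun κ => (x.shift μ) κ - h)) μ = y μ then (1 : ℝ) else 0) + (1 - p (((x.shift μ) μ - h).val % P.L ^ k)) * (if (iterBlockOf k (fun κ => (x.shift μ) κ - h)) μ + 1 = y μ then (1 : ℝ) else 0)) - 2 * (p ((x μ - h).val % P.L ^ k) * (if (iterBlockOf k (fun κ => x κ - h)) μ = y μ then (1 : ℝ) else 0) + (1 - p ((x μ - h).val % P.L ^ k)) * (if (iterBlockOf k (fun κ => x κ - h)) μ + 1 = y μ then (1 : ℝ) else 0)) + (p (((x.unshift μ) μ - h).val % P.L ^ k) * (if (iterBlockOf k (fun κ => (x.unshift μ) κ - h)) μ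 = y μ then (1 : ℝ) else 0) + (1 - p (((x.unshift μ) μ - h).val % P.L ^ k)) * (if (iterBlockOf k (fun κ => (x.unshift μ) κ - h)) μ + 1 = y μ then (1 : ℝ) else 0))| * ∏ ν ∈ Finset.univ.erase μ, (p ((x ν - h).val % P.L ^ k) * (if (iterBlockOf k (fun κ => x κ - h)) ν = y ν then (1 : ℝ) else 0) + (1 - p ((x ν - h).val % P.L ^ k)) * (if (iterBlockOf k (fun κ => x κ - h)) ν + 1 = y ν then (1 : ℝ) else 0)) := by
    intro y
    rw [secondDiff_weight_eq hk h p y μ x, abs_mul, abs_of_nonneg (Finset.prod_nonneg fun ν _ => hnn ν (y ν))]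
  simp only [hpt]
  rw [sum_prod_factor μ (fun t => |(p (((x.shift μ) μ - h).val % P.L ^ k) * (if (iterBlockOf k (fun κ => (x.shift μ) κ - h)) μ = t then (1 : ℝ) else 0) + (1 - p (((x.shift μ) μ - h).val % P.L ^ k)) * (if (iterBlockOf k (fun κ => (x.shift μ) κ - h)) μ + 1 = t then (1 : ℝ) else 0)) - 2 * (p ((x μ - h).val % P.L ^ k) * (if (iterBlockOf k (fun κ => x κ - h)) μ = t then (1 : ℝ) else 0) + (1 - p ((x μ - h).val % P.L ^ k)) * (if (iterBlockOf k (fun κ => x κ - h)) μ + 1 = t then (1 : ℝ) else 0)) + (p (((x.unshift μ) μ - h).val % P.L ^ k) * (if (iterBlockOf k (fun κ => (x.unshift μ) κ - h)) μ = t then (1 : ℝ) else 0) + (1 - p (((x.unshift μ) μ - h).val % P.L ^ k)) * (if (iterBlockOf k (fun κ => (x.unshift μ) κ - h)) μ + 1 = t then (1 : ℝ) else 0))|) (fun ν t => (p ((x ν - h).val % P.L ^ k) * (if (iterBlockOf k (fun κ => x κ - h)) ν = t then (1 : ℝ) else 0) + (1 - p ((x ν - h).val % P.L ^ k)) * (if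 (iterBlockOf k (fun κ => x κ - h)) ν + 1 = t then (1 : ℝ) else 0)))]
  have hG : ∏ ν ∈ Finset.univ.erase μ, ∑ t : ZMod (P.sitesPerDir k), (p ((x ν - h).val % P.L ^ k) * (if (iterBlockOf k (fun κ => x κ - h)) ν = t then (1 : ℝ) else 0) + (1 - p ((x ν - h).val % P.L ^ k)) * (if (iterBlockOf k (fun κ => x κ - h)) ν + 1 = t then (1 : ℝ) else 0)) = 1 :=
    Finset.prod_eq_one fun ν _ => sum_weightE h p ν x
  rw [hG, mul_one]
  exact sum_abs_secondDiff_weightE_le hk h p hp0 hpℓ hpD hpc hpk0 hpk μ x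

end Weight

end Summit.QuantumFields.YangMills.Theorems.Prop7HermiteCardinalWeightsMass

end
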